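import Summits.HodgeConjecture.HodgeConjecture.Cruxes.BlochSeedDiscOne.SeedChecker
import Summits.HodgeConjecture.HodgeConjecture.Cruxes.BlochSeedDiscOne.StrengthenRank4Closure
import HarnessLib

/-!
# SeedCheckerNewtonClosure — v23 of the C5–C8 seed checker (hsemireg-c5c8-1 g22, 2026-08-30): **(R4) THE RANK-`r`
NEWTON CLOSURE, TYPED INTO THE SEED CHECKER** — a predicate on the design json, a predicate on the presentation's own
Chern character, the named law that links them to the object, and the vector-bundle doors it closes.

D-0145 token: `line stmt-HodgeConjecture-18881 Cruxes/BlochSeedDiscOne/Lines/birth.lean 814a6a70c14e831a stub_rung_pad4_seedAt`.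

**Honest framing.** EVIDENCE ∕ TYPED FILE, NOT A RUNG. Nothing here is proved toward HC ∕ HC_CM ∕ HC_AV ∕ №4 ∕ 26512 ∕
18881 ∕ H2: no bundle, sheaf, section or zero scheme is exhibited, no design passing (A1) + (R4) with `μ ≠ 0` is exhibited,
the law `NewtonRankVanishing` is a HYPOTHESIS (neither proved nor asserted), and `stub_rung_pad4_seedAt` stays open. The file
imports only the BUILT v4 `SeedChecker` and `StrengthenRank4Closure` (the satellites v5–v22 are not built on the farm
snapshot and are not imported); it is ADDITIVE (no earlier declaration is touched) and lives in the sub-namespace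
`…SeedChecker.NewtonClosure`.

**Why (R4) and why here.** Of the four C5–C8 checks of the cell's mint — (σ) Hodge-class, (A1@Z), (pad4)-compatibility,
(d = 1) — all were typed in v1–v4 and refined in v5–v22; the one NECESSARY CONDITION every design of record fails, the
rank-`4` closure «`c₅ = c₆ = c₇ = c₈ = 0` for the rank-`4` bundle `𝓔(H)`» (bc5-plan g12 THEOREM LF; MEMO-06; director R19.428's
gating test «(A1) + (R4) with `μ ≠ 0`»), existed only as pen + `import Mathlib` arithmetic
(`StrengthenRank4Closure.c5H3*`) and python (`r4screen.py`), never as a predicate on (design json, presentation) linked to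
`Design.RealisedBy` and the doors of the checker. v23 types exactly that, so the «seed checker» rejects an (R4)-failing
design BEFORE any presentation is written, and states what a candidate presentation's `ch` must satisfy whatever json
produced it.

**Contents.**
* §23.1 ALGEBRA (any commutative ring): the integer Newton polynomials `P_k(λ) = k!·e_k` in the power sums
  `λ_i = p_i` (`newtonP1 … newtonP8`, dispatcher `newtonP`), their Newton recursions `newtonPk_rec` [`ring`], `map_newtonP`
  (ring homs commute), and the LINK `c5H3_eq`: `StrengthenRank4Closure.c5H3 λ₁…λ₅ = 336·P₅(λ)` [`ring`] — the record digits
  `c₅·H³` ARE `(8!∕5!)·P₅`.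
* §23.2 OBJECT (the v4 carrier `H^{2•}(X(ℂ); ℂ)` with the tree's `cupProduct`): the power sums `powerSum C X 𝓕 i = i!·ch_i(𝓕)`,
  the NEWTON CLASSES `newtonChern1 … newtonChern8` (`N_k = (1∕k)·Σ_{i<k… } (−1)^{i−1} p_i ∪ N_{k−i}`, dispatcher `newtonChern`,
  `N₀ = 1`), the letter-coordinate predicates `CleanPowerSums C X 𝓕 h w l` (`p_i = l_i·hⁱ`, `p₄ = l₄·h⁴ + 24·w`) and
  `HPrimitive h w` (`w ∪ hʲ = 0 = hʲ ∪ w`, `j ≥ 1` — the shape of v13∕v14's `pad4_wOf_cupProduct_hPow_eq_zero`), and the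
  COORDINATE THEOREMS `newtonChernk_eq` [kernel-checked, `simp` + `module`]: `N_k = (P_k(l)∕k!)·h^k` for `k ≠ 4, 8`,
  `N₄ = (P₄∕24)·h⁴ − 6·w` (v4's «the `W`-coordinate of `c₄` is `−6μ`», again), and `N₈ = (P₈∕8! + 18·g)·h⁸` when `w ∪ w = g·h⁸`
  — the `W`-part of `ch₄` FEEDS BACK into degree `8` through `p₄ ∪ N₄`; this `+18·(w ∪ w)` is MEMO-06's `+36|μ|²`.
* §23.3 THE LAW `NewtonRankVanishing C` (a `Prop`, hypothesis only: `HasRankLE 𝓕 r → N_k(𝓕) = 0` for `r < k ≤ 8`; Fulton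
  Thm. 3.2 (a) + Example 3.2.3; the Betti twin of the tree's `ChernClassTheory.chern_eq_zero_of_hasRankLE`; NOT derivable from
  `ChernCharacterBetti`'s fields) and its CONSEQUENCES [proved]: `newtonP_eq_zero_of_hasRankLE` (`P_k(l) = 0`, `r < k ≤ 7`,
  `k = 4` by cupping with `h⁴`), `newtonP8_rel_of_hasRankLE` (`P₈∕8! + 18g = 0`), THE RANK WALL `w_eq_zero_of_hasRankLE_le_three`
  (rank `≤ 3 ⟹ w = 0`: B1♯'s rank-`4` floor, object side, from the law), the numerical predicate `NewtonClosedNum r γ l n`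
  (`P_k = 0` for `r < k ≤ 7`, `P₈ + 18γn = 0` if `r < 8`; `_four_iff`, `_of_le` (EMPTY at `r ≥ 8`), `.mono`), and
  **(R4@Z) `newtonClosedNum_of_cleanPowerSums`** — THE OBJECT-SIDE CHECK: a rank-`≤ r` module with rational clean coordinates
  `(l, w)`, `w` `h`-primitive, `8!·(w ∪ w) = γ·n·h⁸`, `h⁸ ≠ 0`, satisfies `NewtonClosedNum r γ l n` — no design mentioned.
* §23.4 JSON: `lamQ D` (`λ_i(D) = c_i(D)`, v4 `Design.coeff`), **(R4@json) `NewtonClosed D r γ := NewtonClosedNum r γ λ(D) |μ(D)|²`**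
  (DECIDABLE on the json: integer polynomial identities in `c₀(D) … c₈(D)`, `μ(D)`), the kit-level hypothesis `FrameGram F h γ`
  (`8!·(wOf μ ∪ wOf μ) = γ|μ|²·h⁸`; frame of record `γ = 2`, MEMO-06 `∫w_μ² = 2|μ|²` — design-independent, once per anchor, like
  O-W ∕ O-pol ∕ O-hyp), the dictionary `cleanPowerSums_of_realisedBy` (`RealisedBy ⟹` coordinates `(λ(D) ⊗ ℂ, wOf μ(D))`,
  factorials cancel), and THE DOOR THEOREMS [proved, axioms `propext ∕ Classical.choice ∕ Quot.sound`]: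
  `newtonClosed_of_realisedBy` (law + `RealisedBy` + `HasRankLE 𝓔 r` + primitivity + Gram + `h⁸ ≠ 0` ⟹ `NewtonClosed D r γ`),
  its contrapositive `not_realisedBy_of_not_newtonClosed` (A FAILING DESIGN IS REALISED BY NO MODULE OF RANK `≤ r`), the
  sheaf door `newtonClosed_of_sheafSeedCheckR` (v2 `SheafSeedCheckR r`), the lci door with a realising rank-`4` bundle
  `newtonClosed_four_of_realisedBy_hasRank` (v4 `seedCheck_of_twistedKernelPresentation`'s inputs), and the json rank wall
  `not_realisedBy_of_rank_le_three` (`μ ≠ 0 ⟹` no realisation of rank `≤ 3`).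
* §23.5 FLAGS [`norm_num`]: NOT IMPLIED BY C0–C4 — the designs of record M72 `1840bf64`, № 46 `9266fa35`, LINE-14 `ac808a66`
  FAIL already in degree `5` (`records_fail_degree_five`, `records_not_newtonClosed`; `c5H3_m72_eq` identifies the digit with
  `StrengthenRank4Closure.c5H3_M72 ∕ 336`); NOT VACUOUS numerically — the target tuple (★)
  `λ = (4, 42, 428, 4248, 41008, 381792, 3356096, 26447232, 158297856)`, `|μ|² = 5017600 = 2240²`, `γ = 2` PASSES
  (`star_newtonClosedNum`: `P₅ = P₆ = P₇ = 0`, `P₈ = −36·|μ|²`) and fails at rank `≤ 3` (`star_not_closed_rank_three`) — whether an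
  (A1)-clean DESIGN with these coefficients exists is the cell's open search (R19.428), not claimed here.
* §23.6 INVARIANCE [`ring` ∕ `linear_combination`]: the twist rows `twLam` (`λ(D(t))`, v4 `tw_coeff`; bridge `lamQ_tw` PROVED
  from `tw_coeff`), the twist law of the Newton numbers at `λ₀ = 4` (`P₅' = P₅`, `P₆' = P₆ − 6tP₅`, `P₇' = P₇ − 14tP₆ + 42t²P₅`,
  `P₈' = P₈ − 24tP₇ + 168t²P₆ − 336t³P₅`), hence `newtonClosedNum_four_twLam_iff` ∕ `newtonClosed_tw_iff` (THE RANK-`4` CLOSURE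
  IS TWIST-INVARIANT: json-innocent under `D ↦ D(t)`, like C0 and `μ`), and the sign frame `negLam` (`h ↦ −h`:
  `P_k ↦ (−1)^k P_k`, `newtonClosedNum_four_negLam_iff`) — so the record verdicts hold in the stored frame too
  (`records_not_newtonClosed_either_frame`).

**FLAGS (the memo `SEED-CHECKER-C5C8-c5c8-1-g22.md` has the table).** (R4@json) is a NECESSARY condition at every
VECTOR-BUNDLE door of the checker (lci-with-realisation at `r = 4`; sheaf door `SheafSeedCheckR r` with `HasRankLE 𝓔 r`),
GENUINELY NEW relative to C0–C4 (decidable on the json; every design of record passes C0 and fails it), NOT VACUOUS as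
arithmetic ((★)), and RANK-SENSITIVE: EMPTY at `r ≥ 8` (`newtonClosed_of_le` — the R-B rooms' rank-`≥ 8` padded designs are
untouched), strongest at `r = 4`, and at `r ≤ 3` it is the rank wall `μ = 0`. It is EVADED — correctly, not by a loophole —
by every door that asserts NO rank-`r` locally free realisation of the design tensor: the coherent ∕ torsion doors (v19 ∕ v20:
no `HasRankLE`), the two-term and monad presentations read only through `ch` of their ENDS (v3: the middle sheaf's rank is
whatever exactness gives; (R4) then constrains that sheaf's own coordinates via (R4@Z), not the cells'), and the degeneracy ∕
Porteous door (v5). The law's two companions on the kit — `HPrimitive` (v13∕v14 prove it for the frame of record) and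
`FrameGram` (`γ = 2`, v14's Gram computation) — and `h⁸ ≠ 0` (v12 `deg h_std = 8! > 0`) are HYPOTHESES here because those
satellites are not built on the farm snapshot; they are design-independent.
-/

noncomputable section

set_option linter.dupNamespace false

open CategoryTheory AlgebraicGeometry
open Literature.AlgebraicGeometry Literature.AlgebraicGeometry.Motives Literature.AlgebraicGeometry.HodgeTheory
open Literature.AlgebraicTopology.SingularHomology

namespace Summit.HodgeConjecture.HodgeConjecture.Cruxes.BlochSeedDiscOne.SeedChecker.NewtonClosure

open Summit.HodgeConjecture.HodgeConjecture.Cruxes.BlochSeedDiscOne.Anchor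
open Summit.Ventures.HSemireg Summit.Ventures.HSemireg.Pad4Tower

/-! ### §23.1 The integer Newton polynomials `P_k = k!·e_k(p₁, …, p_k)` (pure algebra, any commutative ring) -/

section NewtonPolynomials

variable {R : Type*} [CommRing R]

def newtonP1 (l : ℕ → R) : R := l 1

def newtonP2 (l : ℕ → R) : R := l 1 ^ 2 - l 2

def newtonP3 (l : ℕ → R) : R := l 1 ^ 3 - 3 * l 1 * l 2 + 2 * l 3

def newtonP4 (l : ℕ → R) : R := l 1 ^ 4 - 6 * l 1 ^ 2 * l 2 + 8 * l 1 * l 3 + 3 * l 2 ^ 2 - 6 * l 4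

def newtonP5 (l : ℕ → R) : R :=
  l 1 ^ 5 - 10 * l 1 ^ 3 * l 2 + 20 * l 1 ^ 2 * l 3 + 15 * l 1 * l 2 ^ 2 - 30 * l 1 * l 4 - 20 * l 2 * l 3 + 24 * l 5

def newtonP6 (l : ℕ → R) : R :=
  l 1 ^ 6 - 15 * l 1 ^ 4 * l 2 + 40 * l 1 ^ 3 * l 3 + 45 * l 1 ^ 2 * l 2 ^ 2 - 90 * l 1 ^ 2 * l 4 - 120 * l 1 * l 2 * l 3 +
    144 * l 1 * l 5 - 15 * l 2 ^ 3 + 90 * l 2 * l 4 + 40 * l 3 ^ 2 - 120 * l 6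

def newtonP7 (l : ℕ → R) : R :=
  l 1 ^ 7 - 21 * l 1 ^ 5 * l 2 + 70 * l 1 ^ 4 * l 3 + 105 * l 1 ^ 3 * l 2 ^ 2 - 210 * l 1 ^ 3 * l 4 -
    420 * l 1 ^ 2 * l 2 * l 3 + 504 * l 1 ^ 2 * l 5 - 105 * l 1 * l 2 ^ 3 + 630 * l 1 * l 2 * l 4 + 280 * l 1 * l 3 ^ 2 -
    840 * l 1 * l 6 + 210 * l 2 ^ 2 * l 3 - 504 * l 2 * l 5 - 420 * l 3 * l 4 + 720 * l 7

def newtonP8 (l : ℕ → R) : R :=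
  l 1 ^ 8 - 28 * l 1 ^ 6 * l 2 + 112 * l 1 ^ 5 * l 3 + 210 * l 1 ^ 4 * l 2 ^ 2 - 420 * l 1 ^ 4 * l 4 -
    1120 * l 1 ^ 3 * l 2 * l 3 + 1344 * l 1 ^ 3 * l 5 - 420 * l 1 ^ 2 * l 2 ^ 3 + 2520 * l 1 ^ 2 * l 2 * l 4 +
    1120 * l 1 ^ 2 * l 3 ^ 2 - 3360 * l 1 ^ 2 * l 6 + 1680 * l 1 * l 2 ^ 2 * l 3 - 4032 * l 1 * l 2 * l 5 -
    3360 * l 1 * l 3 * l 4 + 5760 * l 1 * l 7 + 105 * l 2 ^ 4 - 1260 * l 2 ^ 2 * l 4 - 1120 * l 2 * l 3 ^ 2 +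
    3360 * l 2 * l 6 + 2688 * l 3 * l 5 + 1260 * l 4 ^ 2 - 5040 * l 8

/-- dispatcher `P_k`, `k ≤ 8` (`P₀ = 1`; `0` above `8`, unused). -/
def newtonP (k : ℕ) (l : ℕ → R) : R :=
  match k with
  | 0 => 1
  | 1 => newtonP1 l
  | 2 => newtonP2 l
  | 3 => newtonP3 l
  | 4 => newtonP4 l
  | 5 => newtonP5 l
  | 6 => newtonP6 l
  | 7 => newtonP7 l
  | 8 => newtonP8 l
  | _ => 0

theorem newtonP2_rec (l : ℕ → R) : newtonP2 l = l 1 * newtonP1 l - l 2 := by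
  unfold newtonP2 newtonP1; ring

theorem newtonP3_rec (l : ℕ → R) : newtonP3 l = l 1 * newtonP2 l - 2 * l 2 * newtonP1 l + 2 * l 3 := by
  unfold newtonP3 newtonP2 newtonP1; ring

theorem newtonP4_rec (l : ℕ → R) :
    newtonP4 l = l 1 * newtonP3 l - 3 * l 2 * newtonP2 l + 6 * l 3 * newtonP1 l - 6 * l 4 := by
  unfold newtonP4 newtonP3 newtonP2 newtonP1; ring

theorem newtonP5_rec (l : ℕ → R) :
    newtonP5 l = l 1 * newtonP4 l - 4 * l 2 * newtonP3 l + 12 * l 3 * newtonP2 l - 24 * l 4 * newtonP1 l + 24 * l 5 := by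
  unfold newtonP5 newtonP4 newtonP3 newtonP2 newtonP1; ring

theorem newtonP6_rec (l : ℕ → R) :
    newtonP6 l = l 1 * newtonP5 l - 5 * l 2 * newtonP4 l + 20 * l 3 * newtonP3 l - 60 * l 4 * newtonP2 l +
      120 * l 5 * newtonP1 l - 120 * l 6 := by
  unfold newtonP6 newtonP5 newtonP4 newtonP3 newtonP2 newtonP1; ring

theorem newtonP7_rec (l : ℕ → R) :
    newtonP7 l = l 1 * newtonP6 l - 6 * l 2 * newtonP5 l + 30 * l 3 * newtonP4 l - 120 * l 4 * newtonP3 l +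
      360 * l 5 * newtonP2 l - 720 * l 6 * newtonP1 l + 720 * l 7 := by
  unfold newtonP7 newtonP6 newtonP5 newtonP4 newtonP3 newtonP2 newtonP1; ring

theorem newtonP8_rec (l : ℕ → R) :
    newtonP8 l = l 1 * newtonP7 l - 7 * l 2 * newtonP6 l + 42 * l 3 * newtonP5 l - 210 * l 4 * newtonP4 l +
      840 * l 5 * newtonP3 l - 2520 * l 6 * newtonP2 l + 5040 * l 7 * newtonP1 l - 5040 * l 8 := by
  unfold newtonP8 newtonP7 newtonP6 newtonP5 newtonP4 newtonP3 newtonP2 newtonP1; ring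

/-- ring homomorphisms commute with the `P_k` (used with `ℚ → ℂ`). -/
theorem map_newtonP {S : Type*} [CommRing S] (f : R →+* S) (l : ℕ → R) (k : ℕ) :
    f (newtonP k l) = newtonP k (fun i => f (l i)) := by
  unfold newtonP
  rcases k with _ | _ | _ | _ | _ | _ | _ | _ | _ | _ <;>
    simp [newtonP1, newtonP2, newtonP3, newtonP4, newtonP5, newtonP6, newtonP7, newtonP8, map_sub, map_add, map_mul,
      map_pow, map_ofNat]

/-- `c₅·H³ = 336·P₅` — the polynomial of `StrengthenRank4Closure.c5H3` IS `(8!∕5!)·P₅`. -/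
theorem c5H3_eq (l : ℕ → ℚ) :
    StrengthenRank4Closure.c5H3 (l 1) (l 2) (l 3) (l 4) (l 5) = 336 * newtonP5 l := by
  unfold StrengthenRank4Closure.c5H3 newtonP5; ring

end NewtonPolynomials

/-! ### §23.2 OBJECT side: the Newton classes `N₁ … N₈` of `ch(𝓕)` ON THE CARRIER and their letter coordinates -/

section Carrier

variable (C : ChernCharacterBetti) (X : Motives.SchemeOver ℂ) (𝓕 : X.left.Modules)

/-- the `i`-th POWER SUM of the Chern roots, `p_i(𝓕) = i!·ch_i(𝓕) ∈ H^{2i}(X(ℂ); ℂ)`. [cite: Fulton1998, Example 3.2.3] -/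
def powerSum (i : ℕ) : complexBetti X (2 * i) := ((i.factorial : ℕ) : ℂ) • C.ch X 𝓕 i

def newtonChern1 : complexBetti X (2 * 1) := powerSum C X 𝓕 1

def newtonChern2 : complexBetti X (2 * 2) :=
  (1 / 2 : ℂ) • (cupProduct (rfl : 2 * 1 + 2 * 1 = 2 * 2) (powerSum C X 𝓕 1) (newtonChern1 C X 𝓕) - powerSum C X 𝓕 2)

def newtonChern3 : complexBetti X (2 * 3) :=
  (1 / 3 : ℂ) • (cupProduct (rfl : 2 * 1 + 2 * 2 = 2 * 3) (powerSum C X 𝓕 1) (newtonChern2 C X 𝓕) -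
    cupProduct (rfl : 2 * 2 + 2 * 1 = 2 * 3) (powerSum C X 𝓕 2) (newtonChern1 C X 𝓕) + powerSum C X 𝓕 3)

def newtonChern4 : complexBetti X (2 * 4) :=
  (1 / 4 : ℂ) • (cupProduct (rfl : 2 * 1 + 2 * 3 = 2 * 4) (powerSum C X 𝓕 1) (newtonChern3 C X 𝓕) -
    cupProduct (rfl : 2 * 2 + 2 * 2 = 2 * 4) (powerSum C X 𝓕 2) (newtonChern2 C X 𝓕) +
    cupProduct (rfl : 2 * 3 + 2 * 1 = 2 * 4) (powerSum C X 𝓕 3) (newtonChern1 C X 𝓕) - powerSum C X 𝓕 4)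

def newtonChern5 : complexBetti X (2 * 5) :=
  (1 / 5 : ℂ) • (cupProduct (rfl : 2 * 1 + 2 * 4 = 2 * 5) (powerSum C X 𝓕 1) (newtonChern4 C X 𝓕) -
    cupProduct (rfl : 2 * 2 + 2 * 3 = 2 * 5) (powerSum C X 𝓕 2) (newtonChern3 C X 𝓕) +
    cupProduct (rfl : 2 * 3 + 2 * 2 = 2 * 5) (powerSum C X 𝓕 3) (newtonChern2 C X 𝓕) -
    cupProduct (rfl : 2 * 4 + 2 * 1 = 2 * 5) (powerSum C X 𝓕 4) (newtonChern1 C X 𝓕) + powerSum C X 𝓕 5)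

def newtonChern6 : complexBetti X (2 * 6) :=
  (1 / 6 : ℂ) • (cupProduct (rfl : 2 * 1 + 2 * 5 = 2 * 6) (powerSum C X 𝓕 1) (newtonChern5 C X 𝓕) -
    cupProduct (rfl : 2 * 2 + 2 * 4 = 2 * 6) (powerSum C X 𝓕 2) (newtonChern4 C X 𝓕) +
    cupProduct (rfl : 2 * 3 + 2 * 3 = 2 * 6) (powerSum C X 𝓕 3) (newtonChern3 C X 𝓕) -
    cupProduct (rfl : 2 * 4 + 2 * 2 = 2 * 6) (powerSum C X 𝓕 4) (newtonChern2 C X 𝓕) +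
    cupProduct (rfl : 2 * 5 + 2 * 1 = 2 * 6) (powerSum C X 𝓕 5) (newtonChern1 C X 𝓕) - powerSum C X 𝓕 6)

def newtonChern7 : complexBetti X (2 * 7) :=
  (1 / 7 : ℂ) • (cupProduct (rfl : 2 * 1 + 2 * 6 = 2 * 7) (powerSum C X 𝓕 1) (newtonChern6 C X 𝓕) -
    cupProduct (rfl : 2 * 2 + 2 * 5 = 2 * 7) (powerSum C X 𝓕 2) (newtonChern5 C X 𝓕) +
    cupProduct (rfl : 2 * 3 + 2 * 4 = 2 * 7) (powerSum C X 𝓕 3) (newtonChern4 C X 𝓕) -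
    cupProduct (rfl : 2 * 4 + 2 * 3 = 2 * 7) (powerSum C X 𝓕 4) (newtonChern3 C X 𝓕) +
    cupProduct (rfl : 2 * 5 + 2 * 2 = 2 * 7) (powerSum C X 𝓕 5) (newtonChern2 C X 𝓕) -
    cupProduct (rfl : 2 * 6 + 2 * 1 = 2 * 7) (powerSum C X 𝓕 6) (newtonChern1 C X 𝓕) + powerSum C X 𝓕 7)

def newtonChern8 : complexBetti X (2 * 8) :=
  (1 / 8 : ℂ) • (cupProduct (rfl : 2 * 1 + 2 * 7 = 2 * 8) (powerSum C X 𝓕 1) (newtonChern7 C X 𝓕) -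
    cupProduct (rfl : 2 * 2 + 2 * 6 = 2 * 8) (powerSum C X 𝓕 2) (newtonChern6 C X 𝓕) +
    cupProduct (rfl : 2 * 3 + 2 * 5 = 2 * 8) (powerSum C X 𝓕 3) (newtonChern5 C X 𝓕) -
    cupProduct (rfl : 2 * 4 + 2 * 4 = 2 * 8) (powerSum C X 𝓕 4) (newtonChern4 C X 𝓕) +
    cupProduct (rfl : 2 * 5 + 2 * 3 = 2 * 8) (powerSum C X 𝓕 5) (newtonChern3 C X 𝓕) -
    cupProduct (rfl : 2 * 6 + 2 * 2 = 2 * 8) (powerSum C X 𝓕 6) (newtonChern2 C X 𝓕) +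
    cupProduct (rfl : 2 * 7 + 2 * 1 = 2 * 8) (powerSum C X 𝓕 7) (newtonChern1 C X 𝓕) - powerSum C X 𝓕 8)

/-- dispatcher `N_k(𝓕) ∈ H^{2k}(X(ℂ); ℂ)`, `k ≤ 8` (`N₀ = 1`; `0` above `8`, where nothing is defined here). -/
def newtonChern : (k : ℕ) → complexBetti X (2 * k)
  | 0 => singularCohomology.one ℂ (Motives.ComplexPoints X)
  | 1 => newtonChern1 C X 𝓕
  | 2 => newtonChern2 C X 𝓕
  | 3 => newtonChern3 C X 𝓕
  | 4 => newtonChern4 C X 𝓕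
  | 5 => newtonChern5 C X 𝓕
  | 6 => newtonChern6 C X 𝓕
  | 7 => newtonChern7 C X 𝓕
  | 8 => newtonChern8 C X 𝓕
  | _ + 9 => 0

variable {C X 𝓕}

/-- **LETTER COORDINATES of `ch(𝓕)` against `(h, w)` in the window `{1, …, 8}`**: `p_i(𝓕) = l_i·hⁱ` for `i ≠ 4` and
`p₄(𝓕) = l₄·h⁴ + 24·w` (i.e. `ch₄ = (l₄∕24)·h⁴ + w`). -/
structure CleanPowerSums (C : ChernCharacterBetti) (X : Motives.SchemeOver ℂ) (𝓕 : X.left.Modules)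
    (h : complexBetti X 2) (w : complexBetti X (2 * 4)) (l : ℕ → ℂ) : Prop where
  p1 : powerSum C X 𝓕 1 = l 1 • cupPowTwo h 1
  p2 : powerSum C X 𝓕 2 = l 2 • cupPowTwo h 2
  p3 : powerSum C X 𝓕 3 = l 3 • cupPowTwo h 3
  p4 : powerSum C X 𝓕 4 = l 4 • cupPowTwo h 4 + (24 : ℂ) • w
  p5 : powerSum C X 𝓕 5 = l 5 • cupPowTwo h 5
  p6 : powerSum C X 𝓕 6 = l 6 • cupPowTwo h 6
  p7 : powerSum C X 𝓕 7 = l 7 • cupPowTwo h 7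
  p8 : powerSum C X 𝓕 8 = l 8 • cupPowTwo h 8

/-- **`h`-PRIMITIVITY of `w`** (both orders): `w ∪ hʲ = 0 = hʲ ∪ w` for `j ≥ 1`. -/
structure HPrimitive {X : Motives.SchemeOver ℂ} (h : complexBetti X 2) (w : complexBetti X (2 * 4)) : Prop where
  wh : ∀ (j k : ℕ) (hdeg : 2 * 4 + 2 * j = k), 0 < j → cupProduct hdeg w (cupPowTwo h j) = 0
  hw : ∀ (j k : ℕ) (hdeg : 2 * j + 2 * 4 = k), 0 < j → cupProduct hdeg (cupPowTwo h j) w = 0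

variable {h : complexBetti X 2} {w : complexBetti X (2 * 4)} {l : ℕ → ℂ}

/-- `hⁱ ∪ hʲ = hⁱ⁺ʲ` (v4 `cupProduct_cupPowTwo_cupPowTwo`, respelled with the sum `m` named). -/
theorem hh (h : complexBetti X 2) (i j m : ℕ) (hm : i + j = m) (hdeg : 2 * i + 2 * j = 2 * m) :
    cupProduct hdeg (cupPowTwo h i) (cupPowTwo h j) = cupPowTwo h m := by
  subst hm
  exact SeedChecker.cupProduct_cupPowTwo_cupPowTwo h i j hdeg

theorem newtonChern1_eq (hc : CleanPowerSums C X 𝓕 h w l) : newtonChern1 C X 𝓕 = newtonP1 l • cupPowTwo h 1 := by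
  rw [newtonChern1, hc.p1, newtonP1]

theorem newtonChern2_eq (hc : CleanPowerSums C X 𝓕 h w l) :
    newtonChern2 C X 𝓕 = (newtonP2 l / 2) • cupPowTwo h 2 := by
  rw [newtonP2_rec]
  simp only [newtonChern2, newtonChern1_eq hc, hc.p1, hc.p2, map_smul, LinearMap.smul_apply, smul_smul, hh h 1 1 2 rfl]
  module

theorem newtonChern3_eq (hc : CleanPowerSums C X 𝓕 h w l) :
    newtonChern3 C X 𝓕 = (newtonP3 l / 6) • cupPowTwo h 3 := by
  rw [newtonP3_rec]
  simp only [newtonChern3, newtonChern2_eq hc, newtonChern1_eq hc, hc.p1, hc.p2, hc.p3, map_smul, LinearMap.smul_apply,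
    smul_smul, hh h 1 2 3 rfl, hh h 2 1 3 rfl]
  module

theorem newtonChern4_eq (hc : CleanPowerSums C X 𝓕 h w l) :
    newtonChern4 C X 𝓕 = (newtonP4 l / 24) • cupPowTwo h 4 - (6 : ℂ) • w := by
  rw [newtonP4_rec]
  simp only [newtonChern4, newtonChern3_eq hc, newtonChern2_eq hc, newtonChern1_eq hc, hc.p1, hc.p2, hc.p3, hc.p4,
    map_smul, LinearMap.smul_apply, smul_smul, hh h 1 3 4 rfl, hh h 2 2 4 rfl, hh h 3 1 4 rfl]
  module

theorem newtonChern5_eq (hc : CleanPowerSums C X 𝓕 h w l) (hp : HPrimitive h w) :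
    newtonChern5 C X 𝓕 = (newtonP5 l / 120) • cupPowTwo h 5 := by
  rw [newtonP5_rec]
  simp only [newtonChern5, newtonChern4_eq hc, newtonChern3_eq hc, newtonChern2_eq hc, newtonChern1_eq hc, hc.p1, hc.p2,
    hc.p3, hc.p4, hc.p5, map_smul, map_sub, map_add, LinearMap.smul_apply, LinearMap.add_apply, smul_smul,
    hh h 1 4 5 rfl, hh h 2 3 5 rfl, hh h 3 2 5 rfl, hh h 4 1 5 rfl,
    hp.hw 1 (2 * 5) rfl one_pos, hp.wh 1 (2 * 5) rfl one_pos, smul_zero, sub_zero, add_zero]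
  module

theorem newtonChern6_eq (hc : CleanPowerSums C X 𝓕 h w l) (hp : HPrimitive h w) :
    newtonChern6 C X 𝓕 = (newtonP6 l / 720) • cupPowTwo h 6 := by
  rw [newtonP6_rec]
  simp only [newtonChern6, newtonChern5_eq hc hp, newtonChern4_eq hc, newtonChern3_eq hc, newtonChern2_eq hc,
    newtonChern1_eq hc, hc.p1, hc.p2, hc.p3, hc.p4, hc.p5, hc.p6, map_smul, map_sub, map_add,
    LinearMap.smul_apply, LinearMap.add_apply, smul_smul, hh h 1 5 6 rfl, hh h 2 4 6 rfl, hh h 3 3 6 rfl, hh h 4 2 6 rfl, hh h 5 1 6 rfl,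
    hp.hw 2 (2 * 6) rfl two_pos, hp.wh 2 (2 * 6) rfl two_pos, smul_zero, sub_zero, add_zero]
  module

theorem newtonChern7_eq (hc : CleanPowerSums C X 𝓕 h w l) (hp : HPrimitive h w) :
    newtonChern7 C X 𝓕 = (newtonP7 l / 5040) • cupPowTwo h 7 := by
  rw [newtonP7_rec]
  simp only [newtonChern7, newtonChern6_eq hc hp, newtonChern5_eq hc hp, newtonChern4_eq hc, newtonChern3_eq hc,
    newtonChern2_eq hc, newtonChern1_eq hc, hc.p1, hc.p2, hc.p3, hc.p4, hc.p5, hc.p6, hc.p7, map_smul, map_sub, map_add,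
    LinearMap.smul_apply, LinearMap.add_apply, smul_smul, hh h 1 6 7 rfl, hh h 2 5 7 rfl, hh h 3 4 7 rfl,
    hh h 4 3 7 rfl, hh h 5 2 7 rfl, hh h 6 1 7 rfl, hp.hw 3 (2 * 7) rfl three_pos, hp.wh 3 (2 * 7) rfl three_pos,
    smul_zero, sub_zero, add_zero]
  module

/-- **degree `8`: `N₈ = (P₈∕8! + 18·g)·h⁸`** where `w ∪ w = g·h⁸` — the `W`-part of `ch₄` feeds back `+18·(w ∪ w)` through `p₄ ∪ N₄`. -/
theorem newtonChern8_eq (hc : CleanPowerSums C X 𝓕 h w l) (hp : HPrimitive h w) {g : ℂ}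
    (hww : cupProduct (rfl : 2 * 4 + 2 * 4 = 2 * 8) w w = g • cupPowTwo h 8) :
    newtonChern8 C X 𝓕 = (newtonP8 l / 40320 + 18 * g) • cupPowTwo h 8 := by
  rw [newtonP8_rec]
  simp only [newtonChern8, newtonChern7_eq hc hp, newtonChern6_eq hc hp, newtonChern5_eq hc hp, newtonChern4_eq hc,
    newtonChern3_eq hc, newtonChern2_eq hc, newtonChern1_eq hc, hc.p1, hc.p2, hc.p3, hc.p4, hc.p5, hc.p6, hc.p7, hc.p8,
    map_smul, map_sub, map_add, LinearMap.smul_apply, LinearMap.add_apply, smul_smul, hh h 1 7 8 rfl, hh h 2 6 8 rfl,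
    hh h 3 5 8 rfl, hh h 4 4 8 rfl, hh h 5 3 8 rfl, hh h 6 2 8 rfl, hh h 7 1 8 rfl, hp.hw 4 (2 * 8) rfl four_pos,
    hp.wh 4 (2 * 8) rfl four_pos, hww, smul_zero, add_zero, zero_add]
  module

end Carrier

/-! ### §23.3 THE LAW (R4) and its consequences on the carrier -/

section Law

/-- **THE LAW (R4): NEWTON CLASSES VANISH ABOVE THE RANK.** For an `𝒪_X`-module `𝓕` of rank `≤ r`
(`Motives.HasRankLE 𝓕 r`: locally FREE of rank `≤ r` — `HasRankLE.isVectorBundle`) the Newton classes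
`N_k(ch(𝓕)) = c_k(𝓕) ⊗ ℂ` of §23.2 vanish for `r < k ≤ 8`. A `Prop`, NOT proved, NOT asserted, consumed only as a
hypothesis (exactly as v4's `TopChernFourLocalisation`): for vector bundles it is Fulton Thm. 3.2 (a) (`c_k(E) = 0` for
`k > rank E`) read through the Chern character (Fulton Example 3.2.3: `ch(E) = Σᵢ exp(αᵢ)`, so `k!·ch_k = p_k(α)` and
Newton's identities make `N_k = e_k(α) = c_k`); it is the Betti-side twin of the tree's
`ChernClassTheory.chern_eq_zero_of_hasRankLE` (stated there for a Weil cohomology's own `c_k^W`) and is NOT derivable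
from `ChernCharacterBetti`'s fields (no rank ∕ vanishing field). [cite: Fulton1998, Thm. 3.2 (a) and Example 3.2.3] -/
def NewtonRankVanishing (C : ChernCharacterBetti) : Prop :=
  ∀ (X : Motives.SchemeOver ℂ) (𝓕 : X.left.Modules) (r : ℕ), HasRankLE 𝓕 r →
    ∀ k : ℕ, r < k → k ≤ 8 → newtonChern C X 𝓕 k = 0

variable {C : ChernCharacterBetti} {X : Motives.SchemeOver ℂ} {𝓕 : X.left.Modules}
  {h : complexBetti X 2} {w : complexBetti X (2 * 4)} {l : ℕ → ℂ}

/-- a lower power of `h` is nonzero when a higher one is. -/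
theorem cupPowTwo_ne_zero_of_le (h : complexBetti X 2) {i m : ℕ} (him : i ≤ m) (hm : cupPowTwo h m ≠ 0) :
    cupPowTwo h i ≠ 0 := by
  intro hi
  apply hm
  obtain ⟨j, rfl⟩ := Nat.exists_eq_add_of_le him
  rw [← hh h i j (i + j) rfl (by ring), hi, map_zero, LinearMap.zero_apply]

theorem eq_zero_of_smul_cupPowTwo_eq_zero (h : complexBetti X 2) {i : ℕ} (hi : cupPowTwo h i ≠ 0) {a : ℂ}
    (ha : a • cupPowTwo h i = 0) : a = 0 :=
  (smul_eq_zero.1 ha).resolve_right hi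

/-- **(R4) ON THE CARRIER, degrees `≤ 7`.** Under the law, a module of rank `≤ r` whose Chern character has letter
coordinates `(l, w)` against `h` (`h⁸ ≠ 0`, `w` `h`-primitive) has `P_k(l) = 0` for every `r < k ≤ 7`
(`k = 4` included: cup `N₄ = (P₄∕24)·h⁴ − 6·w = 0` with `h⁴`). -/
theorem newtonP_eq_zero_of_hasRankLE (hlaw : NewtonRankVanishing C) {r : ℕ} (hrk : HasRankLE 𝓕 r)
    (hc : CleanPowerSums C X 𝓕 h w l) (hp : HPrimitive h w) (hh8 : cupPowTwo h 8 ≠ 0) :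
    ∀ k : ℕ, r < k → k ≤ 7 → newtonP k l = 0 := by
  intro k hrk' hk7
  have hN := hlaw X 𝓕 r hrk k hrk' (by omega)
  have hne : ∀ i, i ≤ 8 → cupPowTwo h i ≠ 0 := fun i hi => cupPowTwo_ne_zero_of_le h hi hh8
  have hk1 : 1 ≤ k := by omega
  interval_cases k
  · change newtonChern1 C X 𝓕 = 0 at hN
    rw [newtonChern1_eq hc] at hN
    exact eq_zero_of_smul_cupPowTwo_eq_zero h (hne 1 (by norm_num)) hN
  · change newtonChern2 C X 𝓕 = 0 at hN
    rw [newtonChern2_eq hc] at hN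
    show newtonP2 l = 0
    simpa using eq_zero_of_smul_cupPowTwo_eq_zero h (hne 2 (by norm_num)) hN
  · change newtonChern3 C X 𝓕 = 0 at hN
    rw [newtonChern3_eq hc] at hN
    show newtonP3 l = 0
    simpa using eq_zero_of_smul_cupPowTwo_eq_zero h (hne 3 (by norm_num)) hN
  · change newtonChern4 C X 𝓕 = 0 at hN
    rw [newtonChern4_eq hc] at hN
    have h2 : cupProduct (rfl : 2 * 4 + 2 * 4 = 2 * 8) (cupPowTwo h 4)
        ((newtonP4 l / 24) • cupPowTwo h 4 - (6 : ℂ) • w) = 0 := by rw [hN, map_zero]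
    simp only [map_sub, map_smul, hh h 4 4 8 rfl, hp.hw 4 (2 * 8) rfl four_pos, smul_zero, sub_zero] at h2
    show newtonP4 l = 0
    simpa using eq_zero_of_smul_cupPowTwo_eq_zero h hh8 h2
  · change newtonChern5 C X 𝓕 = 0 at hN
    rw [newtonChern5_eq hc hp] at hN
    show newtonP5 l = 0
    simpa using eq_zero_of_smul_cupPowTwo_eq_zero h (hne 5 (by norm_num)) hN
  · change newtonChern6 C X 𝓕 = 0 at hN
    rw [newtonChern6_eq hc hp] at hN
    show newtonP6 l = 0
    simpa using eq_zero_of_smul_cupPowTwo_eq_zero h (hne 6 (by norm_num)) hN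
  · change newtonChern7 C X 𝓕 = 0 at hN
    rw [newtonChern7_eq hc hp] at hN
    show newtonP7 l = 0
    simpa using eq_zero_of_smul_cupPowTwo_eq_zero h (hne 7 (by norm_num)) hN

/-- **(R4) ON THE CARRIER, degree `8`.** Under the law, rank `≤ r < 8` and `w ∪ w = g·h⁸` give
`P₈(l)∕8! + 18·g = 0` — the `W`-part of `ch₄` is what a pure-`ℚ[h]` screen misses. -/
theorem newtonP8_rel_of_hasRankLE (hlaw : NewtonRankVanishing C) {r : ℕ} (hrk : HasRankLE 𝓕 r) (hr : r < 8)
    (hc : CleanPowerSums C X 𝓕 h w l) (hp : HPrimitive h w) (hh8 : cupPowTwo h 8 ≠ 0) {g : ℂ}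
    (hww : cupProduct (rfl : 2 * 4 + 2 * 4 = 2 * 8) w w = g • cupPowTwo h 8) :
    newtonP8 l / 40320 + 18 * g = 0 := by
  have hN := hlaw X 𝓕 r hrk 8 hr le_rfl
  change newtonChern8 C X 𝓕 = 0 at hN
  rw [newtonChern8_eq hc hp hww] at hN
  exact eq_zero_of_smul_cupPowTwo_eq_zero h hh8 hN

/-- **THE RANK WALL (B1♯, object side, from the law): rank `≤ 3` forces `w = 0`.** (`N₄ = 0` and `P₄ = 0` leave
`−6·w = 0`.) So a class with a nonzero `W`-coordinate is never `ch₄` of a bundle of rank `≤ 3` — the rank-`4` floor of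
the cell's designs, typed. -/
theorem w_eq_zero_of_hasRankLE_le_three (hlaw : NewtonRankVanishing C) {r : ℕ} (hrk : HasRankLE 𝓕 r) (hr : r ≤ 3)
    (hc : CleanPowerSums C X 𝓕 h w l) (hp : HPrimitive h w) (hh8 : cupPowTwo h 8 ≠ 0) : w = 0 := by
  have hN := hlaw X 𝓕 r hrk 4 (by omega) (by norm_num)
  change newtonChern4 C X 𝓕 = 0 at hN
  rw [newtonChern4_eq hc] at hN
  have hP4 : newtonP 4 l = 0 := newtonP_eq_zero_of_hasRankLE hlaw hrk hc hp hh8 4 (by omega) (by norm_num)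
  change newtonP4 l = 0 at hP4
  rw [hP4, zero_div, zero_smul, zero_sub, neg_eq_zero, smul_eq_zero] at hN
  exact hN.resolve_left (by norm_num)

/-- **THE NUMERICAL CLOSURE at rank `r` with Gram constant `γ`** for a RATIONAL coordinate vector `l` and a `W`-norm `n`:
`P_k(l) = 0` for `r < k ≤ 7`, and `P₈(l) + 18·γ·n = 0` if `r < 8` (empty for `r ≥ 8`). The common shape of (R4@Z) (on a
presentation's own clean coordinates) and (R4@json) (on a design's). -/
def NewtonClosedNum (r : ℕ) (γ : ℚ) (l : ℕ → ℚ) (n : ℚ) : Prop :=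
  (∀ k : ℕ, r < k → k ≤ 7 → newtonP k l = 0) ∧ (r < 8 → newtonP 8 l + 18 * γ * n = 0)

/-- the numerical closure at rank `4`, spelled out: `P₅ = P₆ = P₇ = 0 ∧ P₈ + 18γn = 0`. -/
theorem newtonClosedNum_four_iff (γ : ℚ) (l : ℕ → ℚ) (n : ℚ) :
    NewtonClosedNum 4 γ l n ↔ newtonP5 l = 0 ∧ newtonP6 l = 0 ∧ newtonP7 l = 0 ∧ newtonP8 l + 18 * γ * n = 0 := by
  constructor
  · rintro ⟨hk, h8⟩
    exact ⟨hk 5 (by norm_num) (by norm_num), hk 6 (by norm_num) (by norm_num), hk 7 (by norm_num) (by norm_num),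
      h8 (by norm_num)⟩
  · rintro ⟨h5, h6, h7, h8⟩
    refine ⟨fun k hk hk7 => ?_, fun _ => h8⟩
    interval_cases k
    · exact h5
    · exact h6
    · exact h7

/-- the closure is EMPTY at rank `≥ 8`. -/
theorem newtonClosedNum_of_le {r : ℕ} (hr : 8 ≤ r) (γ : ℚ) (l : ℕ → ℚ) (n : ℚ) : NewtonClosedNum r γ l n :=
  ⟨fun k hk hk7 => by omega, fun h8 => by omega⟩

/-- the closure is MONOTONE in the rank (a smaller rank imposes more identities). -/
theorem NewtonClosedNum.mono {r s : ℕ} (hrs : r ≤ s) {γ : ℚ} {l : ℕ → ℚ} {n : ℚ} (h : NewtonClosedNum r γ l n) :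
    NewtonClosedNum s γ l n :=
  ⟨fun k hk hk7 => h.1 k (by omega) hk7, fun h8 => h.2 (by omega)⟩

/-- `ℚ → ℂ` commutes with the `P_k`. -/
theorem cast_newtonP (lq : ℕ → ℚ) (k : ℕ) : ((newtonP k lq : ℚ) : ℂ) = newtonP k (fun i => ((lq i : ℚ) : ℂ)) := by
  have := map_newtonP (Rat.castHom ℂ) lq k
  simpa using this

/-- **(R4@Z) — THE CLOSURE ON A PRESENTATION'S OWN CLEAN COORDINATES (the OBJECT-side predicate).** Given the law: a
module of rank `≤ r` whose Chern character has RATIONAL letter coordinates `(l, w)` against `h` (`h⁸ ≠ 0`), with `w`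
`h`-primitive and `8!·(w ∪ w) = γ·n·h⁸`, satisfies `NewtonClosedNum r γ l n`. No design is mentioned: this is the
check a candidate presentation's `ch` must pass whatever json produced it. -/
theorem newtonClosedNum_of_cleanPowerSums (hlaw : NewtonRankVanishing C) {r : ℕ} (hrk : HasRankLE 𝓕 r)
    (lq : ℕ → ℚ) (hc : CleanPowerSums C X 𝓕 h w (fun i => ((lq i : ℚ) : ℂ))) (hp : HPrimitive h w)
    (hh8 : cupPowTwo h 8 ≠ 0) {γ n : ℚ}
    (hww : (40320 : ℂ) • cupProduct (rfl : 2 * 4 + 2 * 4 = 2 * 8) w w = (((γ * n : ℚ)) : ℂ) • cupPowTwo h 8) :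
    NewtonClosedNum r γ lq n := by
  refine ⟨fun k hk hk7 => ?_, fun hr8 => ?_⟩
  · have hz := newtonP_eq_zero_of_hasRankLE hlaw hrk hc hp hh8 k hk hk7
    have hmap := cast_newtonP lq k
    rw [hz] at hmap
    exact_mod_cast hmap
  · have h40 : (40320 : ℂ) ≠ 0 := by norm_num
    have hww' : cupProduct (rfl : 2 * 4 + 2 * 4 = 2 * 8) w w = ((((γ * n : ℚ)) : ℂ) / 40320) • cupPowTwo h 8 := by
      rw [div_eq_inv_mul, mul_smul, ← hww, smul_smul, inv_mul_cancel₀ h40, one_smul]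
    have h8 := newtonP8_rel_of_hasRankLE hlaw hrk hr8 hc hp hh8 hww'
    have hmap : ((newtonP 8 lq : ℚ) : ℂ) = newtonP8 (fun i => ((lq i : ℚ) : ℂ)) := cast_newtonP lq 8
    rw [← hmap] at h8
    push_cast at h8
    have h' : ((newtonP 8 lq : ℚ) : ℂ) + 18 * (γ : ℂ) * (n : ℂ) = 0 := by
      linear_combination (40320 : ℂ) * h8
    exact_mod_cast h'

end Law

/-! ### §23.4 JSON side: the closure as a predicate on the design, and the doors it closes -/

section Json

variable {E₀ : AbelianVariety ℂ} {ψ₀ : E₀ ⟶ E₀}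

/-- the design's letter coordinates as a function on `ℕ`: `λ_i(D) = c_i(D)` (`= i!·ch_i`'s `h`-coefficient for an
(A1)-clean design, v4 `Design.coeff`; `λ₀ = rank`), `0` off `{0, …, 8}`. -/
def lamQ (D : Design) (i : ℕ) : ℚ := if hi : i < 9 then (D.coeff ⟨i, hi⟩ : ℚ) else 0

/-- … and complexified (the carrier's scalars). -/
def lamC (D : Design) (i : ℕ) : ℂ := ((lamQ D i : ℚ) : ℂ)

theorem lamQ_eq (D : Design) (p : Fin 9) : lamQ D p = (D.coeff p : ℚ) := by
  simp only [lamQ, dif_pos p.isLt, Fin.eta]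

/-- **(R4@json) THE RANK-`r` NEWTON CLOSURE OF A DESIGN**: the numerical closure of `λ(D)` with `n = |μ(D)|²`
(`Zsqrtd.norm`: `Re² + Im²` on `ℤ[i]`). A DECIDABLE predicate on the json alone (integer polynomial identities in the
nine coefficients `c₀(D), …, c₈(D)` and `μ(D)`); for the frame of record `γ = 2` (§23.4 `FrameGram`) the top identity is
MEMO-06's `8!·e₈ + 36·|μ|² = 0`. -/
def NewtonClosed (D : Design) (r : ℕ) (γ : ℚ) : Prop := NewtonClosedNum r γ (lamQ D) (D.mu.norm : ℚ)

/-- the closure of a design at rank `4`, spelled out: `P₅ = P₆ = P₇ = 0 ∧ P₈ + 18γ|μ|² = 0`. -/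
theorem newtonClosed_four_iff (D : Design) (γ : ℚ) :
    NewtonClosed D 4 γ ↔ newtonP5 (lamQ D) = 0 ∧ newtonP6 (lamQ D) = 0 ∧ newtonP7 (lamQ D) = 0 ∧
      newtonP8 (lamQ D) + 18 * γ * (D.mu.norm : ℚ) = 0 := by
  constructor
  · rintro ⟨hk, h8⟩
    exact ⟨hk 5 (by norm_num) (by norm_num), hk 6 (by norm_num) (by norm_num), hk 7 (by norm_num) (by norm_num),
      h8 (by norm_num)⟩
  · rintro ⟨h5, h6, h7, h8⟩
    refine ⟨fun k hk hk7 => ?_, fun _ => h8⟩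
    interval_cases k
    · exact h5
    · exact h6
    · exact h7

/-- the closure of a design is EMPTY at rank `≥ 8` (the R-B rooms' rank-`≥ 8` designs are not constrained here). -/
theorem newtonClosed_of_le (D : Design) {r : ℕ} (hr : 8 ≤ r) (γ : ℚ) : NewtonClosed D r γ :=
  newtonClosedNum_of_le hr γ _ _

/-- **GRAM CONSTANT `γ` OF A WEIL FRAME against `h`**: `8!·(wOf μ ∪ wOf μ) = γ·|μ|²·h⁸` for every `μ ∈ ℤ[i]` — the
self-intersection of the frame's Weil classes in the unit `∫ h⁸ = 8!`. For the `e ∕ ē` frame of record `γ = 2`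
(MEMO-06: `∫ w_μ² = 2|μ|²`); a `GL₂(ℚ)`-changed frame has a binary form in `(Re μ, Im μ)` instead — restate then.
A hypothesis on the kit (design-independent, once per anchor), like O-W ∕ O-pol ∕ O-hyp. -/
def FrameGram (F : WeilFrame E₀ ψ₀) (h : complexBetti (pad4Anchor E₀).X 2) (γ : ℚ) : Prop :=
  ∀ μ : GaussianInt, (40320 : ℂ) • cupProduct (rfl : 2 * 4 + 2 * 4 = 2 * 8) (F.wOf μ) (F.wOf μ) =
    (((γ * (μ.norm : ℚ) : ℚ)) : ℂ) • cupPowTwo h 8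

variable {C : ChernCharacterBetti} {D : Design} {F : WeilFrame E₀ ψ₀} {h : complexBetti (pad4Anchor E₀).X 2}
  {𝓔 : (pad4Anchor E₀).X.left.Modules}

/-- realisation gives the power sums `p_i(𝓔) = λ_i(D)·hⁱ`, `i ≠ 4` (factorials cancel) … -/
theorem powerSum_of_realisedBy (hR : D.RealisedBy C F h 𝓔) {p : ℕ} (hp9 : p < 9) (hp4 : p ≠ 4) :
    powerSum C (pad4Anchor E₀).X 𝓔 p = lamC D p • cupPowTwo h p := by
  have hch := hR.2.1 ⟨p, hp9⟩ hp4
  simp only [Fin.val_mk] at hch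
  rw [powerSum, hch, smul_smul, lamC, lamQ, dif_pos hp9]
  congr 1
  have hf : ((p.factorial : ℕ) : ℂ) ≠ 0 := Nat.cast_ne_zero.2 (Nat.factorial_ne_zero p)
  push_cast
  field_simp

/-- … and `p₄(𝓔) = λ₄(D)·h⁴ + 24·wOf μ(D)`. -/
theorem powerSum_four_of_realisedBy (hR : D.RealisedBy C F h 𝓔) :
    powerSum C (pad4Anchor E₀).X 𝓔 4 = lamC D 4 • cupPowTwo h 4 + (24 : ℂ) • F.wOf D.mu := by
  have h4 : lamC D 4 = (((D.coeff 4 : ℤ) : ℚ) : ℂ) := by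
    rw [lamC, lamQ, dif_pos (by norm_num)]
    rfl
  have hf : ((Nat.factorial 4 : ℕ) : ℂ) = 24 := by norm_num [Nat.factorial]
  rw [powerSum, hR.2.2, smul_add, smul_smul, h4, hf]
  congr 2
  push_cast
  ring

/-- **REALISATION ⟹ LETTER COORDINATES `(λ(D) ⊗ ℂ, wOf μ(D))`.** -/
theorem cleanPowerSums_of_realisedBy (hR : D.RealisedBy C F h 𝓔) :
    CleanPowerSums C (pad4Anchor E₀).X 𝓔 h (F.wOf D.mu) (lamC D) where
  p1 := powerSum_of_realisedBy hR (by norm_num) (by norm_num)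
  p2 := powerSum_of_realisedBy hR (by norm_num) (by norm_num)
  p3 := powerSum_of_realisedBy hR (by norm_num) (by norm_num)
  p4 := powerSum_four_of_realisedBy hR
  p5 := powerSum_of_realisedBy hR (by norm_num) (by norm_num)
  p6 := powerSum_of_realisedBy hR (by norm_num) (by norm_num)
  p7 := powerSum_of_realisedBy hR (by norm_num) (by norm_num)
  p8 := powerSum_of_realisedBy hR (by norm_num) (by norm_num)

/-- **SOUNDNESS OF (R4@json) — THE DOOR THEOREM.** Given the law, a design REALISED (v4 `Design.RealisedBy`: (A1) +
`ch_p(𝓔) = (c_p∕p!)·h^p`, `ch₄(𝓔) = (c₄∕24)·h⁴ + wOf μ`) by a module of rank `≤ r`, against an `h` with `h⁸ ≠ 0` and a frame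
whose Weil classes are `h`-primitive with Gram constant `γ`, PASSES the rank-`r` Newton closure. Pure algebra on the carrier
(§23.2) + the law; no geometry. -/
theorem newtonClosed_of_realisedBy (hlaw : NewtonRankVanishing C) {r : ℕ} {γ : ℚ} (hR : D.RealisedBy C F h 𝓔)
    (hrk : HasRankLE 𝓔 r) (hp : HPrimitive h (F.wOf D.mu)) (hγ : FrameGram F h γ) (hh8 : cupPowTwo h 8 ≠ 0) :
    NewtonClosed D r γ :=
  newtonClosedNum_of_cleanPowerSums hlaw hrk (lamQ D) (cleanPowerSums_of_realisedBy hR) hp hh8 (hγ D.mu)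

/-- **CONTRAPOSITIVE — A FAILING DESIGN CLOSES THE VECTOR-BUNDLE DOORS BEFORE ANY PRESENTATION IS WRITTEN**: if
`D` fails the rank-`r` closure, NO module of rank `≤ r` realises it (against such `h`, frame). -/
theorem not_realisedBy_of_not_newtonClosed (hlaw : NewtonRankVanishing C) {r : ℕ} {γ : ℚ}
    (hp : HPrimitive h (F.wOf D.mu)) (hγ : FrameGram F h γ) (hh8 : cupPowTwo h 8 ≠ 0) (hfail : ¬ NewtonClosed D r γ)
    (𝓔 : (pad4Anchor E₀).X.left.Modules) (hrk : HasRankLE 𝓔 r) : ¬ D.RealisedBy C F h 𝓔 :=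
  fun hR => hfail (newtonClosed_of_realisedBy hlaw hR hrk hp hγ hh8)

/-- **THE SHEAF DOOR (v2 `Design.SheafSeedCheckR r`, whose fifth conjunct is `RealisedBy` against `h_std`) READS (R4)**:
a passing (design, sheaf) pair whose sheaf has rank `≤ r` passes the rank-`r` closure. (The rank bound is an OBJECT
hypothesis: `ClassDataR r` records the json rank `c₀(D) = r`, not `HasRankLE 𝓔 r`.) -/
theorem newtonClosed_of_sheafSeedCheckR (hlaw : NewtonRankVanishing C) {r : ℕ} {γ : ℚ} {I : Finset ℕ}
    {K : AnchorKit E₀ ψ₀} {𝓔 : (pad4Anchor E₀).X.left.Modules} (hchk : D.SheafSeedCheckR r C I K 𝓔)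
    (hrk : HasRankLE 𝓔 r) (hp : HPrimitive (hStd E₀ K.η) (K.F.wOf D.mu)) (hγ : FrameGram K.F (hStd E₀ K.η) γ)
    (hh8 : cupPowTwo (hStd E₀ K.η) 8 ≠ 0) : NewtonClosed D r γ :=
  newtonClosed_of_realisedBy hlaw hchk.2.2.2.2 hrk hp hγ hh8

/-- **THE lci DOOR WITH A REALISING RANK-`4` BUNDLE (v4 `seedCheck_of_twistedKernelPresentation` ∕ `…Cokernel…` take
`RealisedBy` + `HasRank 𝓕 4`) READS (R4) AT RANK `4`.** -/
theorem newtonClosed_four_of_realisedBy_hasRank (hlaw : NewtonRankVanishing C) {γ : ℚ}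
    {𝓕 : (pad4Anchor E₀).X.left.Modules} (hR : D.RealisedBy C F h 𝓕) (hrk : HasRank 𝓕 4)
    (hp : HPrimitive h (F.wOf D.mu)) (hγ : FrameGram F h γ) (hh8 : cupPowTwo h 8 ≠ 0) : NewtonClosed D 4 γ :=
  newtonClosed_of_realisedBy hlaw hR hrk.hasRankLE hp hγ hh8

/-- **THE RANK WALL at json level**: under the law a design with `μ ≠ 0` (C0's second conjunct; `ClassDataRankFree`) is
realised by NO module of rank `≤ 3`. -/
theorem not_realisedBy_of_rank_le_three (hlaw : NewtonRankVanishing C) (hμ : D.mu ≠ 0)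
    (hp : HPrimitive h (F.wOf D.mu)) (hh8 : cupPowTwo h 8 ≠ 0) (𝓔 : (pad4Anchor E₀).X.left.Modules) {r : ℕ}
    (hrk : HasRankLE 𝓔 r) (hr : r ≤ 3) : ¬ D.RealisedBy C F h 𝓔 := fun hR =>
  F.wOf_ne_zero hμ (w_eq_zero_of_hasRankLE_le_three hlaw hrk hr (cleanPowerSums_of_realisedBy hR) hp hh8)

end Json

/-! ### §23.5 FLAGS: not implied by C0–C4 (designs of record fail), not vacuous numerically ((★) passes) -/

section Flags

/-- the frame-`−h` coordinates `λ₁ … λ₅` of the BAND design M72 `1840bf64` (+ hub; `StrengthenRank4Closure.c5H3_M72`). -/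
def m72Lam : ℕ → ℚ
  | 1 => 327480
  | 2 => 10925136
  | 3 => 231973056
  | 4 => 4037976576
  | 5 => 62757881856
  | _ => 0

/-- the frame-`−h` coordinates of the BAND design № 46 `9266fa35` (`StrengthenRank4Closure.c5H3_N46`). -/
def n46Lam : ℕ → ℚ
  | 1 => -1536
  | 2 => 448128
  | 3 => 14472384
  | 4 => 305197056
  | 5 => 5344376832
  | _ => 0

/-- the LINE-14 design `ac808a66` (`n = 1704`; `StrengthenRank4Closure.c5H3_LINE14`). -/
def line14Lam : ℕ → ℚ
  | 1 => -1704
  | _ => 0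

/-- **NOT IMPLIED BY C0–C4: the three designs of record (all pass C0; M72 passes C1–C4 per the cell's screens) FAIL the
rank-`4` closure already in degree `5`** — `P₅ ≠ 0`; through `c5H3_eq` these are the digits `c₅·H³ ≠ 0` of
`StrengthenRank4Closure` (bc5-plan g12 THEOREM LF ∕ MEMO-06), divided by `336`. -/
theorem records_fail_degree_five :
    newtonP 5 m72Lam ≠ 0 ∧ newtonP 5 n46Lam ≠ 0 ∧ newtonP 5 line14Lam ≠ 0 := by
  refine ⟨?_, ?_, ?_⟩ <;> norm_num [newtonP, newtonP5, m72Lam, n46Lam, line14Lam]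

theorem records_not_newtonClosed (γ n : ℚ) :
    ¬ NewtonClosedNum 4 γ m72Lam n ∧ ¬ NewtonClosedNum 4 γ n46Lam n ∧ ¬ NewtonClosedNum 4 γ line14Lam n :=
  ⟨fun hc => records_fail_degree_five.1 (hc.1 5 (by norm_num) (by norm_num)),
    fun hc => records_fail_degree_five.2.1 (hc.1 5 (by norm_num) (by norm_num)),
    fun hc => records_fail_degree_five.2.2 (hc.1 5 (by norm_num) (by norm_num))⟩

/-- the same digits as `StrengthenRank4Closure` (`c₅H³ = 336·P₅`): e.g. M72. -/
theorem c5H3_m72_eq : StrengthenRank4Closure.c5H3 327480 10925136 231973056 4037976576 62757881856 =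
    336 * newtonP 5 m72Lam := by
  rw [show (327480 : ℚ) = m72Lam 1 from rfl, show (10925136 : ℚ) = m72Lam 2 from rfl,
    show (231973056 : ℚ) = m72Lam 3 from rfl, show (4037976576 : ℚ) = m72Lam 4 from rfl,
    show (62757881856 : ℚ) = m72Lam 5 from rfl]
  exact c5H3_eq m72Lam

/-- **(★) — the closure is NOT VACUOUS numerically**: the tuple `λ = (4, 42, 428, 4248, 41008, 381792, 3356096,
26447232, 158297856)` with `|μ|² = 5 017 600 = 2240²` and `γ = 2` passes: `P₅ = P₆ = P₇ = 0`, `P₈ = −180 633 600 = −36·|μ|²`.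
Whether an (A1)-CLEAN DESIGN with these coefficients and `μ ≠ 0` exists is the cell's open (A1) + (R4) search (director
R19.428); this theorem only certifies the target tuple. -/
def starLam : ℕ → ℚ
  | 0 => 4
  | 1 => 42
  | 2 => 428
  | 3 => 4248
  | 4 => 41008
  | 5 => 381792
  | 6 => 3356096
  | 7 => 26447232
  | 8 => 158297856
  | _ => 0

theorem star_newtonClosedNum : NewtonClosedNum 4 2 starLam 5017600 := by
  refine ⟨fun k hk hk7 => ?_, fun _ => ?_⟩
  · interval_cases k <;> norm_num [newtonP, newtonP5, newtonP6, newtonP7, starLam]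
  · norm_num [newtonP, newtonP8, starLam]

theorem star_norm : (5017600 : ℤ) = 2240 ^ 2 := by norm_num

/-- (★) fails at every rank `≤ 3` (`P₄(★) ≠ 0`) — consistent with the rank wall. -/
theorem star_not_closed_rank_three (γ : ℚ) : ¬ NewtonClosedNum 3 γ starLam 5017600 := fun hc => by
  have := hc.1 4 (by norm_num) (by norm_num)
  norm_num [newtonP, newtonP4, starLam] at this

end Flags

/-! ### §23.6 TWIST AND SIGN-FRAME INVARIANCE: the closure is json-innocent under `D ↦ D(t)` and `h ↦ −h` -/

section Twist

variable {R : Type*} [CommRing R]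

/-- the coordinates of the TWISTED design `D(t)` (v4 `Design.tw`, the json of `𝓔(tH)`):
`λ_k(D(t)) = Σ_d C(k, d)·t^{k−d}·λ_d(D)` (v4 `tw_coeff`), rows `k ≤ 8` written out. -/
def twLam (t : R) (l : ℕ → R) : ℕ → R
  | 0 => l 0
  | 1 => l 1 + t * l 0
  | 2 => l 2 + 2 * t * l 1 + t ^ 2 * l 0
  | 3 => l 3 + 3 * t * l 2 + 3 * t ^ 2 * l 1 + t ^ 3 * l 0
  | 4 => l 4 + 4 * t * l 3 + 6 * t ^ 2 * l 2 + 4 * t ^ 3 * l 1 + t ^ 4 * l 0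
  | 5 => l 5 + 5 * t * l 4 + 10 * t ^ 2 * l 3 + 10 * t ^ 3 * l 2 + 5 * t ^ 4 * l 1 + t ^ 5 * l 0
  | 6 => l 6 + 6 * t * l 5 + 15 * t ^ 2 * l 4 + 20 * t ^ 3 * l 3 + 15 * t ^ 4 * l 2 + 6 * t ^ 5 * l 1 + t ^ 6 * l 0
  | 7 => l 7 + 7 * t * l 6 + 21 * t ^ 2 * l 5 + 35 * t ^ 3 * l 4 + 35 * t ^ 4 * l 3 + 21 * t ^ 5 * l 2 +
      7 * t ^ 6 * l 1 + t ^ 7 * l 0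
  | 8 => l 8 + 8 * t * l 7 + 28 * t ^ 2 * l 6 + 56 * t ^ 3 * l 5 + 70 * t ^ 4 * l 4 + 56 * t ^ 5 * l 3 +
      28 * t ^ 6 * l 2 + 8 * t ^ 7 * l 1 + t ^ 8 * l 0
  | _ => 0

/-- the coordinates against the OPPOSITE generator `−h`: `λ_k ↦ (−1)^k·λ_k` (the «frame `−h`» of the record digits). -/
def negLam (l : ℕ → R) (k : ℕ) : R := (-1) ^ k * l k

/-- **TWIST LAW OF THE NEWTON NUMBERS AT RANK `λ₀ = 4`** (`= c(E ⊗ L) = Σ c_i(E)(1 + t)^{4−i}` in degrees `5…8`):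
`P₅' = P₅`, `P₆' = P₆ − 6tP₅`, `P₇' = P₇ − 14tP₆ + 42t²P₅`, `P₈' = P₈ − 24tP₇ + 168t²P₆ − 336t³P₅`. [`ring`] -/
theorem newtonP5_twLam (t : R) (l : ℕ → R) (h0 : l 0 = 4) : newtonP5 (twLam t l) = newtonP5 l := by
  simp only [newtonP5, twLam, h0]; ring

theorem newtonP6_twLam (t : R) (l : ℕ → R) (h0 : l 0 = 4) :
    newtonP6 (twLam t l) = newtonP6 l - 6 * t * newtonP5 l := by
  simp only [newtonP6, newtonP5, twLam, h0]; ring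

theorem newtonP7_twLam (t : R) (l : ℕ → R) (h0 : l 0 = 4) :
    newtonP7 (twLam t l) = newtonP7 l - 14 * t * newtonP6 l + 42 * t ^ 2 * newtonP5 l := by
  simp only [newtonP7, newtonP6, newtonP5, twLam, h0]; ring

theorem newtonP8_twLam (t : R) (l : ℕ → R) (h0 : l 0 = 4) :
    newtonP8 (twLam t l) = newtonP8 l - 24 * t * newtonP7 l + 168 * t ^ 2 * newtonP6 l - 336 * t ^ 3 * newtonP5 l := by
  simp only [newtonP8, newtonP7, newtonP6, newtonP5, twLam, h0]; ring

/-- `P_k(negLam l) = (−1)^k·P_k(l)` (weighted homogeneity), `k = 5, …, 8`. [`ring`] -/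
theorem newtonP_negLam (l : ℕ → R) :
    newtonP5 (negLam l) = -newtonP5 l ∧ newtonP6 (negLam l) = newtonP6 l ∧ newtonP7 (negLam l) = -newtonP7 l ∧
      newtonP8 (negLam l) = newtonP8 l := by
  refine ⟨?_, ?_, ?_, ?_⟩
  · simp only [newtonP5, negLam]; ring
  · simp only [newtonP6, negLam]; ring
  · simp only [newtonP7, negLam]; ring
  · simp only [newtonP8, negLam]; ring

/-- **THE RANK-`4` CLOSURE IS TWIST-INVARIANT** on coordinate vectors with `λ₀ = 4` (same `γ`, same `W`-norm — `μ` is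
twist-invariant, v4 `tw_mu`). -/
theorem newtonClosedNum_four_twLam_iff (t : ℚ) (l : ℕ → ℚ) (h0 : l 0 = 4) (γ n : ℚ) :
    NewtonClosedNum 4 γ (twLam t l) n ↔ NewtonClosedNum 4 γ l n := by
  rw [newtonClosedNum_four_iff, newtonClosedNum_four_iff, newtonP5_twLam t l h0, newtonP6_twLam t l h0,
    newtonP7_twLam t l h0, newtonP8_twLam t l h0]
  constructor
  · rintro ⟨h5, h6, h7, h8⟩
    exact ⟨h5, by linear_combination h6 + 6 * t * h5, by linear_combination h7 + 14 * t * h6 + 42 * t ^ 2 * h5,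
      by linear_combination h8 + 24 * t * h7 + 168 * t ^ 2 * h6 + 336 * t ^ 3 * h5⟩
  · rintro ⟨h5, h6, h7, h8⟩
    exact ⟨h5, by linear_combination h6 - 6 * t * h5, by linear_combination h7 - 14 * t * h6 + 42 * t ^ 2 * h5,
      by linear_combination h8 - 24 * t * h7 + 168 * t ^ 2 * h6 - 336 * t ^ 3 * h5⟩

/-- **… AND SIGN-FRAME INVARIANT** (`h ↦ −h`: the record digits of `StrengthenRank4Closure` are quoted in the frame `−h`). -/
theorem newtonClosedNum_four_negLam_iff (l : ℕ → ℚ) (γ n : ℚ) :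
    NewtonClosedNum 4 γ (negLam l) n ↔ NewtonClosedNum 4 γ l n := by
  obtain ⟨e5, e6, e7, e8⟩ := newtonP_negLam l
  rw [newtonClosedNum_four_iff, newtonClosedNum_four_iff, e5, e6, e7, e8, neg_eq_zero, neg_eq_zero]

variable {E₀ : AbelianVariety ℂ} {ψ₀ : E₀ ⟶ E₀}

/-- **THE BRIDGE TO v4's TWIST**: for an (A1)-clean design, `λ(D(t)) = twLam t λ(D)` (v4 `tw_coeff`, the nine binomial
rows evaluated). -/
theorem lamQ_tw (t : ℤ) (D : Design) (hD : D.Clean) (k : ℕ) : lamQ (D.tw t) k = twLam (t : ℚ) (lamQ D) k := by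
  by_cases hk : k < 9
  · have key : ∀ p : Fin 9, lamQ (D.tw t) p =
        ∑ d : Fin 9, (((p : ℕ).choose d : ℕ) : ℚ) * (t : ℚ) ^ ((p : ℕ) - d) * lamQ D d := by
      intro p
      rw [lamQ_eq, Design.tw_coeff t D hD p]
      push_cast
      simp only [lamQ_eq]
    obtain ⟨p, rfl⟩ : ∃ p : Fin 9, (p : ℕ) = k := ⟨⟨k, hk⟩, rfl⟩
    rw [key p]
    fin_cases p <;> simp [Fin.sum_univ_succ, twLam, Nat.choose] <;> ring
  · obtain ⟨j, rfl⟩ : ∃ j, k = j + 9 := ⟨k - 9, by omega⟩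
    have h1 : lamQ (D.tw t) (j + 9) = 0 := by simp [lamQ]
    have h2 : twLam (t : ℚ) (lamQ D) (j + 9) = 0 := by simp [twLam]
    rw [h1, h2]

/-- `λ₀(D) = rank`: for a design of json rank `4` (C0's third conjunct `D.rank = 4`, read through `coeff 0 = rank`) the
twist law applies. Stated with the hypothesis `λ₀ = 4` explicitly. -/
theorem newtonClosed_tw_iff (t : ℤ) (D : Design) (hD : D.Clean) (h0 : lamQ D 0 = 4) (γ : ℚ) :
    NewtonClosed (D.tw t) 4 γ ↔ NewtonClosed D 4 γ := by
  have hl : lamQ (D.tw t) = twLam (t : ℚ) (lamQ D) := funext (lamQ_tw t D hD)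
  rw [NewtonClosed, NewtonClosed, hl, Design.tw_mu, newtonClosedNum_four_twLam_iff (t : ℚ) (lamQ D) h0]

/-- … so the three record FAIL verdicts of §23.5 hold in the stored frame `h` as well as in the quoted frame `−h`. -/
theorem records_not_newtonClosed_either_frame (γ n : ℚ) :
    ¬ NewtonClosedNum 4 γ (negLam m72Lam) n ∧ ¬ NewtonClosedNum 4 γ (negLam n46Lam) n ∧
      ¬ NewtonClosedNum 4 γ (negLam line14Lam) n :=
  ⟨fun hc => (records_not_newtonClosed γ n).1 ((newtonClosedNum_four_negLam_iff _ γ n).1 hc),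
    fun hc => (records_not_newtonClosed γ n).2.1 ((newtonClosedNum_four_negLam_iff _ γ n).1 hc),
    fun hc => (records_not_newtonClosed γ n).2.2 ((newtonClosedNum_four_negLam_iff _ γ n).1 hc)⟩

end Twist

end Summit.HodgeConjecture.HodgeConjecture.Cruxes.BlochSeedDiscOne.SeedChecker.NewtonClosure
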